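import Mathlib
import Summits.NavierStokesRegularity.NavierStokesRegularity.Theorems.FilamentSkeletonRssAnalyticStripLiaSymbolAsymp
import Summits.NavierStokesRegularity.NavierStokesRegularity.Theorems.FilamentSkeletonRssAnalyticStripLiaSymbolNumericsDefs

/-!
# Stub P3 `stub_liaSymbol` (child 28295 of `SkeletonJ1G`) — CERTIFIED NUMERICS, SOUNDNESS I:
# the `e^{−y}` enclosures and the per-cell bracket bounds

Lane ns-filament-19175-p1 g12 (prover), 2026-08-28, `--supports stmt-NavierStokesRegularity-28295 --as helper`.
Proves: `rdn q ≤ q ≤ rup q`; `expNegLo y ≤ e^{−y} ≤ expNegHi y` for rational `y ≥ 0` (Mathlib `Real.exp_bound` at `y/128`, then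
7 certified squarings); `C`, `E` antitone in `p`; and the four cell inequalities on `(a,b]`, `0 < a ≤ b`:
`rdn((b−a)·lb·expNegLo(p/a)) ≤ ∫_{(a,b]} e^{−t}e^{−p/t} ≤ rup((b−a)·ub·expNegHi(p/b))` (and the `E`-versions with `/b`, `/a`)
whenever `lb ≤ e^{−b}`, `e^{−a} ≤ ub`.  Pure proof file over the definitions of `…LiaSymbolNumericsDefs`.

HONEST FRAMING: certified numerics for one explicit real integral, serving a HYPOTHETICAL filament-skeleton line on the
NEGATIVE side of a MODEL route; nothing here bears on Navier–Stokes regularity or blow-up.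
-/

set_option linter.dupNamespace false

noncomputable section

namespace Summit.NavierStokesRegularity.NavierStokesRegularity.Theorems.AnalyticStripLiaSymbol

open Real Set MeasureTheory Filter Topology

namespace Numerics

/-- Rounding down does not increase. -/
theorem rdn_le (q : ℚ) : rdn q ≤ q := by
  unfold rdn
  rw [div_le_iff₀ (by positivity)]
  exact Int.floor_le _

/-- Rounding up does not decrease. -/
theorem le_rup (q : ℚ) : q ≤ rup q := by
  unfold rup
  rw [le_div_iff₀ (by positivity)]
  exact Int.le_ceil _

/-- Rounding down a nonnegative rational stays nonnegative. -/
theorem rdn_nonneg {q : ℚ} (hq : 0 ≤ q) : 0 ≤ rdn q := by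
  unfold rdn
  have : (0:ℤ) ≤ Int.floor (q * 2 ^ prec) := Int.floor_nonneg.mpr (by positivity)
  positivity

/-- `rdn q ≤ q`, cast to `ℝ`. -/
theorem rdn_le_real (q : ℚ) : ((rdn q : ℚ) : ℝ) ≤ q := by exact_mod_cast rdn_le q

/-- `q ≤ rup q`, cast to `ℝ`. -/
theorem le_rup_real (q : ℚ) : ((q : ℚ) : ℝ) ≤ rup q := by exact_mod_cast le_rup q

/-- The Taylor enclosure on `[0,1]` (Mathlib `Real.exp_bound`). -/
theorem taylor_bounds {s : ℚ} (hs0 : 0 ≤ s) (hs1 : s ≤ 1) :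
    ((taylor s - terr s : ℚ) : ℝ) ≤ Real.exp (-(s:ℝ)) ∧ Real.exp (-(s:ℝ)) ≤ ((taylor s + terr s : ℚ) : ℝ) := by
  have hx : |(-(s:ℝ))| ≤ 1 := by
    rw [abs_neg, abs_of_nonneg (by exact_mod_cast hs0)]; exact_mod_cast hs1
  have hb := Real.exp_bound hx (n := NT) (by decide)
  have hT : ((taylor s : ℚ) : ℝ) = ∑ m ∈ Finset.range NT, (-(s:ℝ)) ^ m / m.factorial := by
    unfold taylor; push_cast; rfl
  have hE : ((terr s : ℚ) : ℝ) = |(-(s:ℝ))| ^ NT * ((NT.succ : ℕ) / ((NT.factorial : ℕ) * NT)) := by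
    unfold terr
    rw [abs_neg, abs_of_nonneg (by exact_mod_cast hs0)]
    push_cast
    ring
  rw [abs_sub_le_iff] at hb
  constructor
  · push_cast; rw [hT, hE] at *; linarith [hb.2]
  · push_cast; rw [hT, hE] at *; linarith [hb.1]

/-- The rounded-down squaring chain stays nonnegative. -/
theorem sqLo_nonneg : ∀ (k : ℕ) (q : ℚ), 0 ≤ q → 0 ≤ sqLo k q := by
  intro k; induction k with
  | zero => intro q hq; simpa [sqLo] using hq
  | succ k ih => intro q hq; simp only [sqLo]; exact ih _ (rdn_nonneg (mul_nonneg hq hq))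

/-- Soundness of the rounded-down squaring chain: `sqLo k q ≤ v^(2^k)` if `0 ≤ q ≤ v`. -/
theorem sqLo_le : ∀ (k : ℕ) (q : ℚ) (v : ℝ), 0 ≤ q → (q : ℝ) ≤ v → ((sqLo k q : ℚ) : ℝ) ≤ v ^ (2 ^ k) := by
  intro k; induction k with
  | zero => intro q v _ hqv; simpa [sqLo] using hqv
  | succ k ih =>
    intro q v hq hqv
    simp only [sqLo]
    have hq' : (0:ℝ) ≤ q := by exact_mod_cast hq
    have h1 : ((rdn (q * q) : ℚ) : ℝ) ≤ v ^ 2 := by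
      calc ((rdn (q * q) : ℚ) : ℝ) ≤ ((q * q : ℚ) : ℝ) := rdn_le_real _
        _ = (q:ℝ) * q := by push_cast; ring
        _ ≤ v * v := mul_le_mul hqv hqv hq' (hq'.trans hqv)
        _ = v ^ 2 := by ring
    have := ih (rdn (q * q)) (v ^ 2) (rdn_nonneg (mul_nonneg hq hq)) h1
    rw [← pow_mul] at this
    simpa [pow_succ, mul_comm] using this

/-- Soundness of the rounded-up squaring chain: `v^(2^k) ≤ sqHi k q` if `0 ≤ v ≤ q`. -/
theorem le_sqHi : ∀ (k : ℕ) (q : ℚ) (v : ℝ), 0 ≤ v → v ≤ (q : ℝ) → v ^ (2 ^ k) ≤ ((sqHi k q : ℚ) : ℝ) := by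
  intro k; induction k with
  | zero => intro q v _ hvq; simpa [sqHi] using hvq
  | succ k ih =>
    intro q v hv hvq
    simp only [sqHi]
    have h1 : v ^ 2 ≤ ((rup (q * q) : ℚ) : ℝ) := by
      calc v ^ 2 = v * v := by ring
        _ ≤ (q:ℝ) * q := mul_le_mul hvq hvq hv (hv.trans hvq)
        _ = ((q * q : ℚ) : ℝ) := by push_cast; ring
        _ ≤ ((rup (q * q) : ℚ) : ℝ) := le_rup_real _
    have := ih (rup (q * q)) (v ^ 2) (by positivity) h1
    rw [← pow_mul] at this
    simpa [pow_succ, mul_comm] using this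

/-- `e^{−y} = (e^{−y/128})^{128}`. -/
theorem exp_neg_eq_pow (y : ℝ) : Real.exp (-y) = Real.exp (-(y / 2 ^ KS)) ^ (2 ^ KS) := by
  rw [← Real.exp_nat_mul]; congr 1; norm_num [KS]; ring

/-- **Lower enclosure**: `expNegLo y ≤ e^{−y}` for `y ≥ 0`. -/
theorem expNegLo_le {y : ℚ} (hy : 0 ≤ y) : ((expNegLo y : ℚ) : ℝ) ≤ Real.exp (-(y:ℝ)) := by
  unfold expNegLo
  split_ifs with h64
  · push_cast; exact (Real.exp_pos _).le
  · have h64 : y ≤ 64 := not_lt.mp h64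
    set s : ℚ := y / 2 ^ KS with hs
    have hs0 : 0 ≤ s := by rw [hs]; positivity
    have hs1 : s ≤ 1 := by
      rw [hs, div_le_iff₀ (by positivity)]; norm_num [KS]; linarith
    have htb := (taylor_bounds hs0 hs1).1
    set L0 : ℚ := max 0 (rdn (taylor s - terr s)) with hL0
    have hL0n : 0 ≤ L0 := le_max_left _ _
    have hL0le : (L0 : ℝ) ≤ Real.exp (-(s:ℝ)) := by
      rw [hL0]; push_cast
      refine max_le (Real.exp_pos _).le ?_
      exact (rdn_le_real _).trans (by exact_mod_cast htb)
    have := sqLo_le KS L0 (Real.exp (-(s:ℝ))) hL0n hL0le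
    have hrw : Real.exp (-(y:ℝ)) = Real.exp (-(s:ℝ)) ^ (2 ^ KS) := by
      rw [exp_neg_eq_pow]; congr 3; rw [hs]; push_cast; ring
    rw [hrw]; exact this

/-- `0 ≤ expNegLo y`. -/
theorem expNegLo_nonneg (y : ℚ) : 0 ≤ expNegLo y := by
  unfold expNegLo
  split_ifs
  · exact le_rfl
  · exact sqLo_nonneg _ _ (le_max_left _ _)

/-- **Upper enclosure**: `e^{−y} ≤ expNegHi y` for `y ≥ 0`. -/
theorem le_expNegHi {y : ℚ} (hy : 0 ≤ y) : Real.exp (-(y:ℝ)) ≤ ((expNegHi y : ℚ) : ℝ) := by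
  unfold expNegHi expNegHiCore
  set y' : ℚ := min y 64 with hy'
  have hyy : (y' : ℝ) ≤ y := by exact_mod_cast min_le_left y 64
  have hy'0 : 0 ≤ y' := le_min hy (by norm_num)
  have hy'64 : y' ≤ 64 := min_le_right _ _
  have hmono : Real.exp (-(y:ℝ)) ≤ Real.exp (-(y':ℝ)) := Real.exp_le_exp.mpr (by linarith)
  refine hmono.trans ?_
  set s : ℚ := y' / 2 ^ KS with hs
  have hs0 : 0 ≤ s := by rw [hs]; positivity
  have hs1 : s ≤ 1 := by
    rw [hs, div_le_iff₀ (by positivity)]; norm_num [KS]; linarith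
  have htb := (taylor_bounds hs0 hs1).2
  have hU : Real.exp (-(s:ℝ)) ≤ ((rup (taylor s + terr s) : ℚ) : ℝ) := htb.trans (le_rup_real _)
  have := le_sqHi KS (rup (taylor s + terr s)) (Real.exp (-(s:ℝ))) (Real.exp_pos _).le hU
  have hrw : Real.exp (-(y':ℝ)) = Real.exp (-(s:ℝ)) ^ (2 ^ KS) := by
    rw [exp_neg_eq_pow]; congr 3; rw [hs]; push_cast; ring
  rw [hrw]; exact this

/-- The `C`-integrand `e^{−t}e^{−p/t}` is integrable on `(0,∞)` for `p ≥ 0`. -/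
theorem integrableOn_fC {p : ℝ} (hp : 0 ≤ p) :
    IntegrableOn (fun t : ℝ => Real.exp (-t) * Real.exp (-(p / t))) (Ioi 0) := by
  refine (integrableOn_exp_neg_Ioi 0).mono' ?_ ?_
  · exact ((Real.measurable_exp.comp measurable_neg).mul
      (Real.measurable_exp.comp (measurable_const.div measurable_id).neg)).aestronglyMeasurable
  · rw [ae_restrict_iff' measurableSet_Ioi]
    refine Filter.Eventually.of_forall fun t (ht : 0 < t) => ?_
    have h1 : Real.exp (-(p / t)) ≤ 1 := by rw [Real.exp_le_one_iff]; exact neg_nonpos.mpr (div_nonneg hp ht.le)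
    rw [Real.norm_eq_abs, abs_of_nonneg (by positivity)]
    calc Real.exp (-t) * Real.exp (-(p / t)) ≤ Real.exp (-t) * 1 := by gcongr
      _ = Real.exp (-t) := mul_one _

/-- The `C`-integrand is nonnegative. -/
theorem fC_nonneg (p t : ℝ) : 0 ≤ Real.exp (-t) * Real.exp (-(p / t)) := by positivity

/-- The `E`-integrand is nonnegative on `t > 0`. -/
theorem fE_nonneg (p : ℝ) {t : ℝ} (ht : 0 < t) : 0 ≤ Real.exp (-t) * Real.exp (-(p / t)) / t := by positivity

/-- `C` is antitone in `p ≥ 0`. -/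
theorem Cint_antitone {p q : ℝ} (hp : 0 ≤ p) (hpq : p ≤ q) : Cint q ≤ Cint p := by
  unfold Cint
  refine setIntegral_mono_on (integrableOn_fC (hp.trans hpq)) (integrableOn_fC hp) measurableSet_Ioi
    (fun t (ht : 0 < t) => ?_)
  have ht' : 0 ≤ t := ht.le
  exact mul_le_mul_of_nonneg_left (Real.exp_le_exp.mpr (neg_le_neg (div_le_div_of_nonneg_right hpq ht')))
    (Real.exp_pos _).le

/-- `E` is antitone in `p > 0`. -/
theorem Eint_antitone {p q : ℝ} (hp : 0 < p) (hpq : p ≤ q) : Eint q ≤ Eint p := by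
  unfold Eint
  refine setIntegral_mono_on (integrableOn_E_integrand (hp.trans_le hpq)) (integrableOn_E_integrand hp)
    measurableSet_Ioi (fun t (ht : 0 < t) => ?_)
  have ht' : 0 ≤ t := ht.le
  exact div_le_div_of_nonneg_right (mul_le_mul_of_nonneg_left
    (Real.exp_le_exp.mpr (neg_le_neg (div_le_div_of_nonneg_right hpq ht'))) (Real.exp_pos _).le) ht'

/-- `0 ≤ E(p)`. -/
theorem Eint_nonneg (p : ℝ) : 0 ≤ Eint p :=
  setIntegral_nonneg measurableSet_Ioi fun _ ht => fE_nonneg p ht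

/-- Elementary: `(b − a)·m ≤ ∫_{(a,b]} g` when `m ≤ g` there. -/
theorem const_mul_le_setIntegral_Ioc {a b m : ℝ} (hab : a ≤ b) {g : ℝ → ℝ} (hg : IntegrableOn g (Ioc a b))
    (h : ∀ t ∈ Ioc a b, m ≤ g t) : (b - a) * m ≤ ∫ t in Ioc a b, g t := by
  have hc : IntegrableOn (fun _ : ℝ => m) (Ioc a b) := integrableOn_const (hs := measure_Ioc_lt_top.ne)
  have := setIntegral_mono_on hc hg measurableSet_Ioc h
  rwa [setIntegral_const, Real.volume_real_Ioc_of_le hab, smul_eq_mul] at this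

/-- Elementary: `∫_{(a,b]} g ≤ (b − a)·M` when `g ≤ M` there. -/
theorem setIntegral_Ioc_le_const_mul {a b M : ℝ} (hab : a ≤ b) {g : ℝ → ℝ} (hg : IntegrableOn g (Ioc a b))
    (h : ∀ t ∈ Ioc a b, g t ≤ M) : ∫ t in Ioc a b, g t ≤ (b - a) * M := by
  have hc : IntegrableOn (fun _ : ℝ => M) (Ioc a b) := integrableOn_const (hs := measure_Ioc_lt_top.ne)
  have := setIntegral_mono_on hg hc measurableSet_Ioc h
  rwa [setIntegral_const, Real.volume_real_Ioc_of_le hab, smul_eq_mul] at this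

/-- The `C`-integrand is integrable on a cell `(a,b]`, `a > 0`. -/
theorem integrableOn_fC_Ioc {p a b : ℝ} (ha : 0 < a) :
    IntegrableOn (fun t : ℝ => Real.exp (-t) * Real.exp (-(p / t))) (Ioc a b) := by
  have hc : ContinuousOn (fun t : ℝ => Real.exp (-t) * Real.exp (-(p / t))) (Icc a b) := by
    refine ContinuousOn.mul (by fun_prop) (Real.continuous_exp.comp_continuousOn ?_)
    exact (continuousOn_const.div continuousOn_id fun t ht => (ha.trans_le ht.1).ne').neg
  exact (hc.integrableOn_Icc).mono_set Ioc_subset_Icc_self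

/-- The `E`-integrand is integrable on a cell `(a,b]`, `a > 0`. -/
theorem integrableOn_fE_Ioc {p a b : ℝ} (ha : 0 < a) :
    IntegrableOn (fun t : ℝ => Real.exp (-t) * Real.exp (-(p / t)) / t) (Ioc a b) := by
  have hc : ContinuousOn (fun t : ℝ => Real.exp (-t) * Real.exp (-(p / t)) / t) (Icc a b) := by
    refine ContinuousOn.div ?_ continuousOn_id fun t ht => (ha.trans_le ht.1).ne'
    refine ContinuousOn.mul (by fun_prop) (Real.continuous_exp.comp_continuousOn ?_)
    exact (continuousOn_const.div continuousOn_id fun t ht => (ha.trans_le ht.1).ne').neg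
  exact (hc.integrableOn_Icc).mono_set Ioc_subset_Icc_self

/-- Lower cell bound for `C`. -/
theorem cellC_lo {p a b lb : ℚ} (hp : 0 ≤ p) (ha : 0 < a) (hab : a ≤ b)
    (hlb : (lb : ℝ) ≤ Real.exp (-(b:ℝ))) :
    ((rdn ((b - a) * lb * expNegLo (p / a)) : ℚ) : ℝ)
      ≤ ∫ t in Ioc (a:ℝ) b, Real.exp (-t) * Real.exp (-((p:ℝ) / t)) := by
  refine (rdn_le_real _).trans ?_
  push_cast
  have hel := expNegLo_le (div_nonneg hp ha.le : 0 ≤ p / a)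
  have hel0 : (0:ℝ) ≤ expNegLo (p / a) := by exact_mod_cast expNegLo_nonneg _
  rw [mul_assoc]
  refine const_mul_le_setIntegral_Ioc (by exact_mod_cast hab) (integrableOn_fC_Ioc (by exact_mod_cast ha)) ?_
  intro t ht
  have ha' : (0:ℝ) < a := by exact_mod_cast ha
  have ht0 : 0 < t := ha'.trans ht.1
  have h1 : (lb:ℝ) ≤ Real.exp (-t) := hlb.trans (Real.exp_le_exp.mpr (by linarith [ht.2]))
  have h2 : ((expNegLo (p / a) : ℚ) : ℝ) ≤ Real.exp (-((p:ℝ) / t)) := by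
    refine hel.trans ?_
    push_cast
    exact Real.exp_le_exp.mpr (neg_le_neg (div_le_div_of_nonneg_left (by exact_mod_cast hp) ha' ht.1.le))
  exact mul_le_mul h1 h2 hel0 (Real.exp_pos _).le

/-- Upper cell bound for `C`. -/
theorem cellC_hi {p a b ub : ℚ} (hp : 0 ≤ p) (ha : 0 < a) (hab : a ≤ b)
    (hub : Real.exp (-(a:ℝ)) ≤ (ub : ℝ)) :
    ∫ t in Ioc (a:ℝ) b, Real.exp (-t) * Real.exp (-((p:ℝ) / t))
      ≤ ((rup ((b - a) * ub * expNegHi (p / b)) : ℚ) : ℝ) := by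
  refine le_trans ?_ (le_rup_real _)
  push_cast
  have hb : 0 < b := ha.trans_le hab
  have heh := le_expNegHi (div_nonneg hp hb.le : 0 ≤ p / b)
  rw [mul_assoc]
  refine setIntegral_Ioc_le_const_mul (by exact_mod_cast hab) (integrableOn_fC_Ioc (by exact_mod_cast ha)) ?_
  intro t ht
  have ha' : (0:ℝ) < a := by exact_mod_cast ha
  have ht0 : 0 < t := ha'.trans ht.1
  have h1 : Real.exp (-t) ≤ (ub:ℝ) := (Real.exp_le_exp.mpr (by linarith [ht.1])).trans hub
  have h2 : Real.exp (-((p:ℝ) / t)) ≤ ((expNegHi (p / b) : ℚ) : ℝ) := by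
    refine le_trans ?_ heh
    push_cast
    exact Real.exp_le_exp.mpr (neg_le_neg (div_le_div_of_nonneg_left (by exact_mod_cast hp) ht0 ht.2))
  exact mul_le_mul h1 h2 (Real.exp_pos _).le ((Real.exp_pos _).le.trans h1)

/-- Lower cell bound for `E`. -/
theorem cellE_lo {p a b lb : ℚ} (hp : 0 ≤ p) (ha : 0 < a) (hab : a ≤ b)
    (hlb : (lb : ℝ) ≤ Real.exp (-(b:ℝ))) :
    ((rdn ((b - a) * lb * expNegLo (p / a) / b) : ℚ) : ℝ)
      ≤ ∫ t in Ioc (a:ℝ) b, Real.exp (-t) * Real.exp (-((p:ℝ) / t)) / t := by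
  refine (rdn_le_real _).trans ?_
  push_cast
  have hb : 0 < b := ha.trans_le hab
  have hel := expNegLo_le (div_nonneg hp ha.le : 0 ≤ p / a)
  have hel0 : (0:ℝ) ≤ expNegLo (p / a) := by exact_mod_cast expNegLo_nonneg _
  rw [show ((b:ℝ) - a) * lb * (expNegLo (p / a) : ℝ) / b = ((b:ℝ) - a) * (lb * (expNegLo (p / a) : ℝ) / b) by ring]
  refine const_mul_le_setIntegral_Ioc (by exact_mod_cast hab) (integrableOn_fE_Ioc (by exact_mod_cast ha)) ?_
  intro t ht
  have ha' : (0:ℝ) < a := by exact_mod_cast ha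
  have hb' : (0:ℝ) < b := by exact_mod_cast hb
  have ht0 : 0 < t := ha'.trans ht.1
  have h1 : (lb:ℝ) ≤ Real.exp (-t) := hlb.trans (Real.exp_le_exp.mpr (by linarith [ht.2]))
  have h2 : ((expNegLo (p / a) : ℚ) : ℝ) ≤ Real.exp (-((p:ℝ) / t)) := by
    refine hel.trans ?_
    push_cast
    exact Real.exp_le_exp.mpr (neg_le_neg (div_le_div_of_nonneg_left (by exact_mod_cast hp) ha' ht.1.le))
  have h12 : (lb:ℝ) * (expNegLo (p / a) : ℝ) ≤ Real.exp (-t) * Real.exp (-((p:ℝ) / t)) :=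
    mul_le_mul h1 h2 hel0 (Real.exp_pos _).le
  rw [div_le_div_iff₀ hb' ht0]
  exact mul_le_mul h12 ht.2 ht0.le (mul_nonneg (Real.exp_pos _).le (Real.exp_pos _).le)

/-- Upper cell bound for `E`. -/
theorem cellE_hi {p a b ub : ℚ} (hp : 0 ≤ p) (ha : 0 < a) (hab : a ≤ b)
    (hub : Real.exp (-(a:ℝ)) ≤ (ub : ℝ)) :
    ∫ t in Ioc (a:ℝ) b, Real.exp (-t) * Real.exp (-((p:ℝ) / t)) / t
      ≤ ((rup ((b - a) * ub * expNegHi (p / b) / a) : ℚ) : ℝ) := by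
  refine le_trans ?_ (le_rup_real _)
  push_cast
  have hb : 0 < b := ha.trans_le hab
  have heh := le_expNegHi (div_nonneg hp hb.le : 0 ≤ p / b)
  rw [show ((b:ℝ) - a) * ub * (expNegHi (p / b) : ℝ) / a = ((b:ℝ) - a) * (ub * (expNegHi (p / b) : ℝ) / a) by ring]
  refine setIntegral_Ioc_le_const_mul (by exact_mod_cast hab) (integrableOn_fE_Ioc (by exact_mod_cast ha)) ?_
  intro t ht
  have ha' : (0:ℝ) < a := by exact_mod_cast ha
  have ht0 : 0 < t := ha'.trans ht.1
  have h1 : Real.exp (-t) ≤ (ub:ℝ) := (Real.exp_le_exp.mpr (by linarith [ht.1])).trans hub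
  have h2 : Real.exp (-((p:ℝ) / t)) ≤ ((expNegHi (p / b) : ℚ) : ℝ) := by
    refine le_trans ?_ heh
    push_cast
    exact Real.exp_le_exp.mpr (neg_le_neg (div_le_div_of_nonneg_left (by exact_mod_cast hp) ht0 ht.2))
  have h12 : Real.exp (-t) * Real.exp (-((p:ℝ) / t)) ≤ (ub:ℝ) * (expNegHi (p / b) : ℝ) :=
    mul_le_mul h1 h2 (Real.exp_pos _).le ((Real.exp_pos _).le.trans h1)
  rw [div_le_div_iff₀ ht0 ha']
  exact mul_le_mul h12 ht.1.le ha'.le ((mul_nonneg (Real.exp_pos _).le (Real.exp_pos _).le).trans h12)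

end Numerics

end Summit.NavierStokesRegularity.NavierStokesRegularity.Theorems.AnalyticStripLiaSymbol
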